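import Mathlib.Analysis.Calculus.LocalExtr.Basic
import Summits.Ventures.LatticeQCDFlow.Scaling.SwapLadderRoundTripOptimum
import Summits.Ventures.LatticeQCDFlow.Scaling.SwapLadderIndexPoisson

/-!
HONEST FRAMING: exact (Metropolis-corrected) sampling algorithms for lattice gauge theory; figures
of merit are autocorrelation/cost numbers at stated couplings and volumes; no continuum-physics
claim.

# SwapLadderIndexTauIntOptimumShape — THE SHAPE OF A `τ_int`-OPTIMAL SWAP LADDER: STATIONARITY
# `w_i²·G′(ℓ_i) = w_j²·G′(ℓ_j)` (FERMAT ALONG TWO-GAP SHIFTS), HENCE MIRROR SYMMETRY, GAPS STRICTLY DECREASING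
# TOWARDS THE MIDDLE, THE END PAIRS THE LOOSEST, AND — FOR `K ≥ 3` — NEVER THE EQUAL-ACCEPTANCE LADDER
# (row 22 `su3-ptbc`, GEN-7, ours; sequel of `SwapLadderIndexTauIntTuning`)

Venture `LatticeQCDFlow` (cell pub-lqcd), topic `Scaling`; FANOUT row 22 (`su3-ptbc`).  NEW WORK of the cell over GEN-6's
`SwapLadderIndexPoisson` (`passageWeight K j = (j+1)(K−j)`; with `SwapLadderIndexTauInt`: the model replica-index `τ_int`
of a ladder is `(6/(K(K+1)(K+2)))·Σ_{j<K} w_j²/a_j − 1/2`, and `SwapLadderIndexTauIntTuning`'s `indexCost K g` is this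
file's `gapIndexCost K (ladderGap g)` by `rfl` — neither is imported, so that this file needs only BUILT parents),
`SwapLadderRoundTripOptimum` (`G = gaussInvAcc = 1/erfc(·/(2√2))`: `hasDerivAt_gaussInvAcc`, `deriv_gaussInvAcc`,
`strictMono_deriv_gaussInvAcc` — `G′ > 0` strictly increasing, i.e. `G` strictly convex) and Mathlib's Fermat lemma
`IsLocalMin.hasDerivAt_eq_zero`.  Nothing is cited as a fact; no `native_decide`.

THE POINT (model statements, necessary conditions only).  Work with gap vectors `ℓ_0, …, ℓ_{K−1} > 0` of fixed total
stiffness `Λ = Σ_j ℓ_j` (= `K`-interval ladders with fixed endpoints; the ladder reading is spelled out in the sequel).  Call `ℓ`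
INDEX-OPTIMAL if it minimises `gapIndexCost K ℓ = Σ_j w_j²·G(ℓ_j)` over the positive gap vectors of the same
total stiffness (`ℓ ∈ gapSimplex K Λ`, Mathlib's `IsMinOn (gapIndexCost K) (gapSimplex K Λ) ℓ`).
Shifting stiffness `δ` from gap `j` to gap `i` keeps feasibility for small `|δ|` and changes the cost at rate
`w_i²·G′(ℓ_i) − w_j²·G′(ℓ_j)` (`hasDerivAt_gapIndexCost_gapShift`), so at an optimum (Fermat)
**`w_i²·G′(ℓ_i) = w_j²·G′(ℓ_j)` for all pairs** (`stationary_of_isMinOn`).  Since `G′` is strictly increasing and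
the passage weights `w_j = (j+1)(K−j)` are mirror-symmetric, smallest at the ends (`w_0 = w_{K−1} = K`) and strictly
increasing towards the middle, an index-optimal ladder is mirror-symmetric (`gap_symm`), its gaps strictly DECREASE
towards the middle (`gap_succ_lt`: tighter spacing / higher acceptance where `w_j` is large), the two end gaps are
the widest (`gap_lt_gap_zero`) with `G′(ℓ_0) > (2(K−1)/K)²·G′(0)` (`deriv_gap_zero_gt_of_isMinOn`), and for
`K ≥ 3` it is NOT the uniform ladder (`exists_gap_ne_of_isMinOn`, `not_isMinOn_const`) — the equal-acceptance
rule (the unique ROUND-TRIP optimum, GEN-6) and the `τ_int` optimum differ, as `SwapLadderIndexTauIntTuning` showed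
from the other side (a strictly better ladder exists).  Uniqueness and the
SUFFICIENCY of stationarity are the sequel `SwapLadderIndexTauIntOptimumUnique`.  NOT CLAIMED: existence of an
index-optimal ladder — on the CLOSED simplex a minimiser exists by compactness, but it may have ZERO gaps: stationarity forces
`G′(ℓ_1)/G′(ℓ_0) = w_0²/w_1² < 1` (`K ≥ 3`), impossible when all gaps are small (`G′ → G′(0) = 1/√(2π) > 0`), so for
small total stiffness `Λ` the infimum over POSITIVE gap vectors is not attained (middle gaps collapse) and the
theorems below are then vacuous —, its closed form, the size of the gain, anything about PTBC or a run.
-/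

noncomputable section

open Finset Real Filter Topology

namespace Summit.Ventures.LatticeQCDFlow.Scaling

/-! ## §1 Gap vectors, the cost, two-gap shifts -/

section Gaps

variable {K : ℕ}

/-- The index cost of a gap vector: `Σ_{j<K} w_j²·gaussInvAcc(ℓ_j)`. [ours] -/
def gapIndexCost (K : ℕ) (ℓ : ℕ → ℝ) : ℝ := ∑ j ∈ range K, passageWeight K j ^ 2 * gaussInvAcc (ℓ j)

/-- Shift stiffness `δ` from gap `j` to gap `i`. [ours] -/
def gapShift (ℓ : ℕ → ℝ) (i j : ℕ) (δ : ℝ) (k : ℕ) : ℝ :=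
  ℓ k + (if k = i then δ else 0) - (if k = j then δ else 0)

/-- `gapShift ℓ i j 0 = ℓ`. [ours] -/
theorem gapShift_zero (ℓ : ℕ → ℝ) (i j : ℕ) : gapShift ℓ i j 0 = ℓ := by
  funext k; simp [gapShift]

variable {ℓ : ℕ → ℝ} {i j : ℕ} {δ : ℝ}

/-- Gap `i` becomes `ℓ_i + δ`. [ours] -/
theorem gapShift_left (hij : i ≠ j) : gapShift ℓ i j δ i = ℓ i + δ := by
  simp [gapShift, hij]

/-- Gap `j` becomes `ℓ_j − δ`. [ours] -/
theorem gapShift_right (hij : i ≠ j) : gapShift ℓ i j δ j = ℓ j - δ := by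
  simp [gapShift, hij.symm]

/-- The other gaps are unchanged. [ours] -/
theorem gapShift_of_ne {k : ℕ} (hki : k ≠ i) (hkj : k ≠ j) : gapShift ℓ i j δ k = ℓ k := by
  simp [gapShift, hki, hkj]

/-- The total stiffness is unchanged (`i, j < K`). [ours] -/
theorem sum_gapShift (hi : i < K) (hj : j < K) :
    ∑ k ∈ range K, gapShift ℓ i j δ k = ∑ k ∈ range K, ℓ k := by
  unfold gapShift
  rw [sum_sub_distrib, sum_add_distrib, sum_ite_eq' (range K) i, sum_ite_eq' (range K) j, if_pos (mem_range.mpr hi),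
    if_pos (mem_range.mpr hj)]
  ring

/-- **The cost after a shift**: only the two touched terms change. [ours] -/
theorem gapIndexCost_gapShift (hij : i ≠ j) (hi : i < K) (hj : j < K) :
    gapIndexCost K (gapShift ℓ i j δ) = gapIndexCost K ℓ
      + passageWeight K i ^ 2 * (gaussInvAcc (ℓ i + δ) - gaussInvAcc (ℓ i))
      + passageWeight K j ^ 2 * (gaussInvAcc (ℓ j - δ) - gaussInvAcc (ℓ j)) := by
  unfold gapIndexCost
  have key : ∀ k ∈ range K, passageWeight K k ^ 2 * gaussInvAcc (gapShift ℓ i j δ k)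
      = passageWeight K k ^ 2 * gaussInvAcc (ℓ k)
        + (if k = i then passageWeight K i ^ 2 * (gaussInvAcc (ℓ i + δ) - gaussInvAcc (ℓ i)) else 0)
        + (if k = j then passageWeight K j ^ 2 * (gaussInvAcc (ℓ j - δ) - gaussInvAcc (ℓ j)) else 0) := by
    intro k _
    by_cases hki : k = i
    · subst hki
      rw [gapShift_left hij, if_pos rfl, if_neg hij]; ring
    by_cases hkj : k = j
    · subst hkj
      rw [gapShift_right hij, if_neg hki, if_pos rfl]; ring
    rw [gapShift_of_ne hki hkj, if_neg hki, if_neg hkj]; ring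
  rw [sum_congr rfl key, sum_add_distrib, sum_add_distrib, sum_ite_eq' (range K) i, sum_ite_eq' (range K) j,
    if_pos (mem_range.mpr hi), if_pos (mem_range.mpr hj)]

/-- **The rate of change of the cost along the shift at `δ = 0` is `w_i²·G′(ℓ_i) − w_j²·G′(ℓ_j)`.** [ours] -/
theorem hasDerivAt_gapIndexCost_gapShift (hij : i ≠ j) (hi : i < K) (hj : j < K) :
    HasDerivAt (fun δ => gapIndexCost K (gapShift ℓ i j δ))
      (passageWeight K i ^ 2 * deriv gaussInvAcc (ℓ i) - passageWeight K j ^ 2 * deriv gaussInvAcc (ℓ j)) 0 := by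
  have e : (fun δ => gapIndexCost K (gapShift ℓ i j δ)) = fun δ => gapIndexCost K ℓ
      + passageWeight K i ^ 2 * (gaussInvAcc (ℓ i + δ) - gaussInvAcc (ℓ i))
      + passageWeight K j ^ 2 * (gaussInvAcc (ℓ j - δ) - gaussInvAcc (ℓ j)) :=
    funext fun δ => gapIndexCost_gapShift hij hi hj
  rw [e]
  have h1 : HasDerivAt (fun δ => gaussInvAcc (ℓ i + δ)) (deriv gaussInvAcc (ℓ i)) 0 :=
    HasDerivAt.comp_const_add (ℓ i) 0
      (by rw [add_zero]; exact (hasDerivAt_gaussInvAcc (ℓ i)).differentiableAt.hasDerivAt)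
  have h2 : HasDerivAt (fun δ => gaussInvAcc (ℓ j - δ)) (-deriv gaussInvAcc (ℓ j)) 0 :=
    HasDerivAt.comp_const_sub (ℓ j) 0
      (by rw [sub_zero]; exact (hasDerivAt_gaussInvAcc (ℓ j)).differentiableAt.hasDerivAt)
  have h := ((hasDerivAt_const (0 : ℝ) (gapIndexCost K ℓ)).add
    ((h1.sub_const (gaussInvAcc (ℓ i))).const_mul (passageWeight K i ^ 2))).add
    ((h2.sub_const (gaussInvAcc (ℓ j))).const_mul (passageWeight K j ^ 2))
  refine h.congr_deriv ?_
  ring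

end Gaps

/-! ## §2 Index-optimality ⇒ stationarity (Fermat) -/

section Stationary

variable {K : ℕ} {Λ : ℝ} {ℓ : ℕ → ℝ}

/-- The positive gap vectors with `K` gaps and total stiffness `Λ` (= the `K`-interval ladders with fixed endpoints
`g₀`, `g₀ + Λ`). [ours] -/
def gapSimplex (K : ℕ) (Λ : ℝ) : Set (ℕ → ℝ) := {ℓ | (∀ k, k < K → 0 < ℓ k) ∧ ∑ k ∈ range K, ℓ k = Λ}

/-- Membership, unfolded. [ours] -/
theorem mem_gapSimplex : ℓ ∈ gapSimplex K Λ ↔ (∀ k, k < K → 0 < ℓ k) ∧ ∑ k ∈ range K, ℓ k = Λ := Iff.rfl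

variable {i j : ℕ}

/-- A two-gap shift of a feasible vector stays feasible for `−ℓ_i < δ < ℓ_j`. [ours] -/
theorem gapShift_mem_gapSimplex (hℓ : ℓ ∈ gapSimplex K Λ) (hi : i < K) (hj : j < K) (hij : i ≠ j) {δ : ℝ}
    (h1 : -ℓ i < δ) (h2 : δ < ℓ j) : gapShift ℓ i j δ ∈ gapSimplex K Λ := by
  refine ⟨fun k hk => ?_, by rw [sum_gapShift hi hj, hℓ.2]⟩
  by_cases hki : k = i
  · subst hki; rw [gapShift_left hij]; linarith
  by_cases hkj : k = j
  · subst hkj; rw [gapShift_right hij]; linarith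
  rw [gapShift_of_ne hki hkj]; exact hℓ.1 k hk

/-- Along every two-gap shift an index-optimal vector has a local minimum at `δ = 0`. [ours] -/
theorem isLocalMin_gapShift (hℓ : ℓ ∈ gapSimplex K Λ) (hmin : IsMinOn (gapIndexCost K) (gapSimplex K Λ) ℓ)
    (hi : i < K) (hj : j < K) (hij : i ≠ j) :
    IsLocalMin (fun δ => gapIndexCost K (gapShift ℓ i j δ)) 0 := by
  have hev : ∀ᶠ δ in 𝓝 (0 : ℝ), -ℓ i < δ ∧ δ < ℓ j :=
    Ioo_mem_nhds (by linarith [hℓ.1 i hi]) (hℓ.1 j hj)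
  refine hev.mono fun δ hδ => ?_
  show gapIndexCost K (gapShift ℓ i j 0) ≤ gapIndexCost K (gapShift ℓ i j δ)
  rw [gapShift_zero]
  exact isMinOn_iff.mp hmin _ (gapShift_mem_gapSimplex hℓ hi hj hij hδ.1 hδ.2)

/-- **STATIONARITY: `w_i²·G′(ℓ_i) = w_j²·G′(ℓ_j)` for all `i, j < K`** at an index-optimal vector (Fermat). [ours] -/
theorem stationary_of_isMinOn (hℓ : ℓ ∈ gapSimplex K Λ) (hmin : IsMinOn (gapIndexCost K) (gapSimplex K Λ) ℓ)
    (hi : i < K) (hj : j < K) :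
    passageWeight K i ^ 2 * deriv gaussInvAcc (ℓ i) = passageWeight K j ^ 2 * deriv gaussInvAcc (ℓ j) := by
  by_cases hij : i = j
  · subst hij; rfl
  have := (isLocalMin_gapShift hℓ hmin hi hj hij).hasDerivAt_eq_zero (hasDerivAt_gapIndexCost_gapShift hij hi hj)
  linarith

end Stationary

/-! ## §3 The shape of an index-optimal ladder -/

section Shape

variable {K : ℕ} {Λ : ℝ} {ℓ : ℕ → ℝ} {i j : ℕ}

/-- `G′ > 0`. [ours] -/
theorem deriv_gaussInvAcc_pos (x : ℝ) : 0 < deriv gaussInvAcc x := by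
  rw [deriv_gaussInvAcc]; exact mul_pos (gaussInvAcc_pos x) (gaussNegLogDeriv_pos x)

/-- `w_j > 0` for `j < K`. [ours] -/
theorem passageWeight_pos (hj : j < K) : 0 < passageWeight K j := by
  unfold passageWeight
  have h1 : (0 : ℝ) < (j : ℝ) + 1 := by positivity
  have h2 : (0 : ℝ) < (K : ℝ) - j := by
    have : (j : ℝ) + 1 ≤ K := by exact_mod_cast hj
    linarith
  exact mul_pos h1 h2

/-- **Larger weight ⇒ smaller gap**: `w_i < w_j ⇒ ℓ_j < ℓ_i` at an index-optimal vector. [ours] -/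
theorem gap_lt_gap_of_weight_lt (hℓ : ℓ ∈ gapSimplex K Λ) (hmin : IsMinOn (gapIndexCost K) (gapSimplex K Λ) ℓ)
    (hi : i < K) (hj : j < K) (hw : passageWeight K i < passageWeight K j) : ℓ j < ℓ i := by
  have hs := stationary_of_isMinOn hℓ hmin hi hj
  have hwi := passageWeight_pos hi
  have hw2 : passageWeight K i ^ 2 < passageWeight K j ^ 2 := by nlinarith
  by_contra hcon
  have hmono : deriv gaussInvAcc (ℓ i) ≤ deriv gaussInvAcc (ℓ j) :=
    strictMono_deriv_gaussInvAcc.monotone (not_lt.mp hcon)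
  have hpos := deriv_gaussInvAcc_pos (ℓ i)
  have hposj := deriv_gaussInvAcc_pos (ℓ j)
  nlinarith

/-- **Equal weights ⇒ equal gaps.** [ours] -/
theorem gap_eq_gap_of_weight_eq (hℓ : ℓ ∈ gapSimplex K Λ) (hmin : IsMinOn (gapIndexCost K) (gapSimplex K Λ) ℓ)
    (hi : i < K) (hj : j < K) (hw : passageWeight K i = passageWeight K j) : ℓ i = ℓ j := by
  have hs := stationary_of_isMinOn hℓ hmin hi hj
  rw [hw] at hs
  have hwj := passageWeight_pos hj
  have hd : deriv gaussInvAcc (ℓ i) = deriv gaussInvAcc (ℓ j) :=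
    mul_left_cancel₀ (pow_pos hwj 2).ne' hs
  exact strictMono_deriv_gaussInvAcc.injective hd

/-- The weights are mirror-symmetric: `w_{K−1−j} = w_j` (`j < K`). [ours] -/
theorem passageWeight_symm (hj : j < K) : passageWeight K (K - 1 - j) = passageWeight K j := by
  unfold passageWeight
  have e : ((K - 1 - j : ℕ) : ℝ) = (K : ℝ) - 1 - j := by
    rw [Nat.cast_sub (by omega), Nat.cast_sub (by omega)]; push_cast; ring
  rw [e]; ring

/-- **MIRROR SYMMETRY: `ℓ_{K−1−j} = ℓ_j`.** [ours] -/
theorem gap_symm (hℓ : ℓ ∈ gapSimplex K Λ) (hmin : IsMinOn (gapIndexCost K) (gapSimplex K Λ) ℓ) (hj : j < K) :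
    ℓ (K - 1 - j) = ℓ j :=
  gap_eq_gap_of_weight_eq hℓ hmin (by omega) hj (passageWeight_symm hj)

/-- The weights increase strictly towards the middle: `w_j < w_{j+1}` while `2j + 2 < K`. [ours] -/
theorem passageWeight_lt_succ (hj : 2 * j + 2 < K) : passageWeight K j < passageWeight K (j + 1) := by
  unfold passageWeight
  have : (2 : ℝ) * j + 2 < K := by exact_mod_cast hj
  push_cast
  nlinarith

/-- **GAPS STRICTLY DECREASE TOWARDS THE MIDDLE: `ℓ_{j+1} < ℓ_j` while `2j + 2 < K`** (and mirror-wise). [ours] -/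
theorem gap_succ_lt (hℓ : ℓ ∈ gapSimplex K Λ) (hmin : IsMinOn (gapIndexCost K) (gapSimplex K Λ) ℓ)
    (hj : 2 * j + 2 < K) : ℓ (j + 1) < ℓ j :=
  gap_lt_gap_of_weight_lt hℓ hmin (by omega) (by omega) (passageWeight_lt_succ hj)

/-- The end weight is the smallest: `w_0 = K < w_j` for `0 < j < K − 1`. [ours] -/
theorem passageWeight_zero_lt (hj0 : 0 < j) (hj : j + 1 < K) : passageWeight K 0 < passageWeight K j := by
  unfold passageWeight
  push_cast
  have h1 : (1 : ℝ) ≤ j := by exact_mod_cast hj0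
  have h2 : (j : ℝ) + 1 < K := by exact_mod_cast hj
  nlinarith

/-- **THE END PAIRS ARE THE LOOSEST: `ℓ_j < ℓ_0` for every `0 < j < K − 1`.** [ours] -/
theorem gap_lt_gap_zero (hℓ : ℓ ∈ gapSimplex K Λ) (hmin : IsMinOn (gapIndexCost K) (gapSimplex K Λ) ℓ)
    (hj0 : 0 < j) (hj : j + 1 < K) : ℓ j < ℓ 0 :=
  gap_lt_gap_of_weight_lt hℓ hmin (by omega) (by omega) (passageWeight_zero_lt hj0 hj)

/-- **FOR `K ≥ 3` AN INDEX-OPTIMAL LADDER IS NOT UNIFORM** (`ℓ_1 < ℓ_0`). [ours] -/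
theorem exists_gap_ne_of_isMinOn (hℓ : ℓ ∈ gapSimplex K Λ) (hmin : IsMinOn (gapIndexCost K) (gapSimplex K Λ) ℓ)
    (hK : 3 ≤ K) : ∃ k, k < K ∧ ℓ k ≠ ℓ 0 :=
  ⟨1, by omega, (gap_lt_gap_zero hℓ hmin one_pos (by omega)).ne⟩

/-- Equivalently: the uniform gap vector `ℓ_j = Λ/K` is never index-optimal for `K ≥ 3` — consistent with
`exists_ladder_indexCost_lt_uniform`, which exhibits a strictly better ladder. [ours] -/
theorem not_isMinOn_const (hK : 3 ≤ K) (c : ℝ) (hc : (fun _ => c) ∈ gapSimplex K Λ) :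
    ¬ IsMinOn (gapIndexCost K) (gapSimplex K Λ) (fun _ => c) := fun h => by
  obtain ⟨k, _, hk⟩ := exists_gap_ne_of_isMinOn hc h hK
  exact hk rfl

/-- `G′(0) = 1/(2√2) · 2/√π` (`gaussAcc 0 = 1`). [ours] -/
theorem deriv_gaussInvAcc_zero : deriv gaussInvAcc 0 = 2 / sqrt π * (1 / (2 * sqrt 2)) := by
  rw [deriv_gaussInvAcc]
  simp only [gaussInvAcc_apply, gaussAcc_zero, gaussNegLogDeriv, erfcLogDeriv, zero_div, erfc_zero]
  simp

/-- **THE END GAP OF AN INTERIOR OPTIMUM IS BOUNDED BELOW** (`K ≥ 3`): `(2(K−1)/K)²·G′(0) < G′(ℓ_0)` — stationarity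
between pairs `0` and `1` and `G′(ℓ_1) > G′(0)`.  Since `2(K−1)/K ≥ 4/3` and `G′` is strictly increasing, an
index-optimal POSITIVE gap vector can exist only when the total stiffness affords two end gaps above the point where
`G′ = (16/9)·G′(0)`: for small `Λ` the middle gaps collapse (the caveat of the header, quantified). [ours] -/
theorem deriv_gap_zero_gt_of_isMinOn (hℓ : ℓ ∈ gapSimplex K Λ) (hmin : IsMinOn (gapIndexCost K) (gapSimplex K Λ) ℓ)
    (hK : 3 ≤ K) : (2 * ((K : ℝ) - 1) / K) ^ 2 * deriv gaussInvAcc 0 < deriv gaussInvAcc (ℓ 0) := by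
  have hs0 := stationary_of_isMinOn hℓ hmin (show 0 < K by omega) (show 1 < K by omega)
  have e0 : passageWeight K 0 = (K : ℝ) := by simp [passageWeight]
  have e1 : passageWeight K 1 = 2 * ((K : ℝ) - 1) := by simp only [passageWeight]; push_cast; ring
  have hs : (K : ℝ) ^ 2 * deriv gaussInvAcc (ℓ 0) = (2 * ((K : ℝ) - 1)) ^ 2 * deriv gaussInvAcc (ℓ 1) := by
    rw [e0, e1] at hs0; exact hs0
  have hK0 : (0 : ℝ) < K := by exact_mod_cast (show 0 < K by omega)
  have h1 : deriv gaussInvAcc 0 < deriv gaussInvAcc (ℓ 1) := strictMono_deriv_gaussInvAcc (hℓ.1 1 (by omega))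
  have hw : (0 : ℝ) < (2 * ((K : ℝ) - 1)) ^ 2 := by
    have : (3 : ℝ) ≤ K := by exact_mod_cast hK
    exact pow_pos (by linarith) 2
  have e : deriv gaussInvAcc (ℓ 0) = (2 * ((K : ℝ) - 1)) ^ 2 * deriv gaussInvAcc (ℓ 1) / (K : ℝ) ^ 2 := by
    rw [eq_div_iff (pow_pos hK0 2).ne']; linarith
  rw [e, div_pow, div_mul_eq_mul_div, lt_div_iff₀ (pow_pos hK0 2), div_mul_cancel₀ _ (pow_pos hK0 2).ne']
  exact mul_lt_mul_of_pos_left h1 hw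

/-- **Every gap of an interior optimum is bounded below through ANY weight**: for all `i, j < K`,
`w_i²·G′(0) < w_j²·G′(ℓ_j)` (the common value `μ = w_i²·G′(ℓ_i)` exceeds `w_i²·G′(0)` because `ℓ_i > 0`).  With
`i` a middle index this is the model's COLLAPSE THRESHOLD: a positive optimum needs total stiffness
`Λ > Σ_j (G′)⁻¹((w_max/w_j)²·G′(0))` (desk numerics: `≈ 10.9` for `K = 12`, against `≈ 30.8` for the flat-`20 %`
ladder). [ours] -/
theorem weight_sq_mul_deriv_zero_lt (hℓ : ℓ ∈ gapSimplex K Λ) (hmin : IsMinOn (gapIndexCost K) (gapSimplex K Λ) ℓ)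
    (hi : i < K) (hj : j < K) :
    passageWeight K i ^ 2 * deriv gaussInvAcc 0 < passageWeight K j ^ 2 * deriv gaussInvAcc (ℓ j) := by
  rw [← stationary_of_isMinOn hℓ hmin hi hj]
  exact mul_lt_mul_of_pos_left (strictMono_deriv_gaussInvAcc (hℓ.1 i hi)) (pow_pos (passageWeight_pos hi) 2)

/-- THE DRIVER's DEO SCHEME HAS THE SAME OPTIMAL LADDERS: its index functional `Σ_j w_j²·r_j/s_j = Σ_j w_j²·(G(ℓ_j) − 1)`
(`s_j = gaussAcc ℓ_j`, `r_j = 1 − s_j`; the staged `SwapLadderIndexTauIntDEO`) differs from `gapIndexCost` by the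
gap-independent constant `Σ_j w_j²`, so §2–§3 apply verbatim to it. [ours] -/
theorem sum_passageWeight_sq_mul_sub_one (K : ℕ) (ℓ : ℕ → ℝ) :
    ∑ j ∈ range K, passageWeight K j ^ 2 * (gaussInvAcc (ℓ j) - 1)
      = gapIndexCost K ℓ - ∑ j ∈ range K, passageWeight K j ^ 2 := by
  unfold gapIndexCost
  rw [← sum_sub_distrib]
  exact sum_congr rfl fun j _ => by ring

/-- Hence the DEO index functional is minimised on `gapSimplex K Λ` by exactly the same gap vectors. [ours] -/
theorem isMinOn_deo_iff (K : ℕ) (Λ : ℝ) (ℓ : ℕ → ℝ) :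
    IsMinOn (fun ℓ' : ℕ → ℝ => ∑ j ∈ range K, passageWeight K j ^ 2 * (gaussInvAcc (ℓ' j) - 1)) (gapSimplex K Λ) ℓ
      ↔ IsMinOn (gapIndexCost K) (gapSimplex K Λ) ℓ := by
  simp only [isMinOn_iff, sum_passageWeight_sq_mul_sub_one, sub_le_sub_iff_right]

end Shape

end Summit.Ventures.LatticeQCDFlow.Scaling

end
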